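import Summits.Parity.GeneralizedHardyLittlewood.Theorems.BeyondDiagonalBeatsQuarter.OffDiagCharacterSublattice
import Mathlib.NumberTheory.DirichletCharacter.Orthogonality
import Mathlib.RingTheory.RootsOfUnity.AlgebraicallyClosed
import Mathlib.Data.Nat.Factorization.Basic
import HarnessLib

/-!
# Route `PrimeLevelFamEdge`, crux K_B (stmt-Parity-20343), line `diagonal_kernel_split` rev 4, plan Ω —
# `OffDiagCoreSmallConductorCount` (line lead 2026-08-28T17:25:44Z, optional last node), stage 1: **the character /
# height arithmetic of the SMALL-CONDUCTOR residual (S) — a trivial kernel number** (twin of `OffDiagCoreTallCount`)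

After `OffDiagCharacterBlock` / `OffDiagCharacterSublattice` the small-conductor part of the dual core is, per surviving
(modulus `m = |h₁|/e`, character `ψ mod d`, `1 < d ≤ R`), a sum over the heights `j` of the box `(B₀, B)` lying on the
lattice `{j : d·j = 0 in ℤ/m}` of `(𝓕w)(j)·(sample of the box weight at height j)`, `w = ψ ∘ (mod d)` on `ℤ/m`. This file
prices that object TRIVIALLY (no cancellation), free of K_B objects:

* `norm_dft_le_sum_norm`, `norm_dft_le_card` — `‖(𝓕w)(j)‖ ≤ Σ_x ‖w x‖ ≤ m` for `‖w‖ ≤ 1`;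
* `card_heights_lattice_le` — `#{j ∈ ℤ/m : 0 < j.val ≤ T, d·j = 0} ≤ T/(m/d)` for `d ∣ m` (multiples of `m/d` in `(0, T]`,
  Mathlib `Nat.Ioc_filter_dvd_card_eq_div`);
* **`norm_sum_lattice_samples_le`** — for any samples `g j` with `‖g j‖ ≤ S` and `‖w‖ ≤ 1`:
  `‖Σ_{j : 0 < j.val ≤ T, d·j = 0} (𝓕w)(j)·g j‖ ≤ (T/(m/d))·m·S` (so `≤ T·d·S` up to rounding: the `d`-periodic twisted block
  of modulus `m` costs at most `d` short-modulus principal samples' worth);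
* `sum_Icc_totient_mul_le`, **`sum_Icc_card_dirichletCharacter_mul_le`** — `Σ_{d ≤ R} #{ψ mod d}·d ≤ R³`: the
  number of (character, conductor-weight) pairs the (S) residual sums over, i.e. the (S)/(U) trivial-mass RATIO is `≤ R³`
  with the trivial DFT bound (the line lead's `R^{5/2}` would need `|τ(ψ)| = √cond` for all primitive `ψ`, which Mathlib
  has only over fields).

Stage 2 (threading these through `OffDiagCoreSplit.coreS` once the residual is exposed by name, in `ms`-currency against
`OffDiagCoreTallCount`) is the residual consumer's. No cancellation is claimed; (S) stays UNFUNDED. Pure arithmetic;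
standard axioms; helper toward `stub_offDiagBelowSlack_io`; closes nothing.
«The programme SEARCHES and TYPES; no claim about Landau–Siegel zeros, Theorems 1–2 of arXiv:2211.02515 or
a repaired Margin232 until a kernel theorem says so.»
-/

noncomputable section

open Finset

namespace Summit.Parity.GeneralizedHardyLittlewood.Theorems.BeyondDiagonalBeatsQuarter.OffDiag

/-! ### §1 The trivial size of a DFT coefficient -/

section DFT

variable {m : ℕ} [NeZero m]

/-- **Trivial bound for a DFT coefficient**: `‖(𝓕w)(j)‖ ≤ Σ_{x mod m} ‖w x‖`. [folklore] -/
theorem norm_dft_le_sum_norm (w : ZMod m → ℂ) (j : ZMod m) :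
    ‖ZMod.dft w j‖ ≤ ∑ x : ZMod m, ‖w x‖ := by
  rw [ZMod.dft_apply]
  refine (norm_sum_le _ _).trans (Finset.sum_le_sum fun x _ ↦ ?_)
  rw [smul_eq_mul, norm_mul, ZMod.stdAddChar_apply, Circle.norm_coe, one_mul]

/-- For a twist of modulus `≤ 1`: `‖(𝓕w)(j)‖ ≤ m`. [folklore] -/
theorem norm_dft_le_card {w : ZMod m → ℂ} (hw : ∀ x, ‖w x‖ ≤ 1) (j : ZMod m) :
    ‖ZMod.dft w j‖ ≤ m := by
  refine (norm_dft_le_sum_norm w j).trans ?_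
  calc ∑ x : ZMod m, ‖w x‖ ≤ ∑ _x : ZMod m, (1 : ℝ) := Finset.sum_le_sum fun x _ ↦ hw x
    _ = m := by rw [Finset.sum_const, Finset.card_univ, ZMod.card, nsmul_eq_mul, mul_one]

end DFT

/-! ### §2 The number of lattice heights in a window -/

section Heights

variable {m d : ℕ} [NeZero m]

/-- `d·j = 0` in `ℤ/m` iff `(m/d) ∣ j.val`, for `d ∣ m`, `d ≥ 1`. [folklore] -/
theorem natCast_mul_eq_zero_iff_dvd_val (hd : d ∣ m) (hd0 : 0 < d) (j : ZMod m) :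
    (d : ZMod m) * j = 0 ↔ m / d ∣ j.val := by
  have hval : (d : ZMod m) * j = ((d * j.val : ℕ) : ZMod m) := by
    push_cast; rw [ZMod.natCast_zmod_val]
  rw [hval, ZMod.natCast_eq_zero_iff]
  obtain ⟨k, hk⟩ := hd
  have hmk : m / d = k := by rw [hk, Nat.mul_div_cancel_left k hd0]
  have h1 : m ∣ d * j.val ↔ d * k ∣ d * j.val := by rw [← hk]
  rw [h1, hmk]
  exact Nat.mul_dvd_mul_iff_left hd0

/-- **Lattice heights in a window**: for `d ∣ m` (`d ≥ 1`) and `T ∈ ℕ`,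
`#{j ∈ ℤ/m : 0 < j.val ≤ T, d·j = 0} ≤ T/(m/d)` (the multiples of `m/d` in `(0, T]`). [folklore] -/
theorem card_heights_lattice_le (hd : d ∣ m) (hd0 : 0 < d) (T : ℕ) :
    ((Finset.univ : Finset (ZMod m)).filter
        (fun j ↦ 0 < j.val ∧ j.val ≤ T ∧ (d : ZMod m) * j = 0)).card ≤ T / (m / d) := by
  classical
  rw [← Nat.Ioc_filter_dvd_card_eq_div T (m / d)]
  refine Finset.card_le_card_of_injOn (fun j ↦ j.val) (fun j hj ↦ ?_) (fun j₁ _ j₂ _ h ↦ ZMod.val_injective m h)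
  rw [Finset.mem_coe, Finset.mem_filter] at hj
  obtain ⟨-, h1, h2, h3⟩ := hj
  rw [Finset.mem_coe, Finset.mem_filter, Finset.mem_Ioc]
  exact ⟨⟨h1, h2⟩, (natCast_mul_eq_zero_iff_dvd_val hd hd0 j).mp h3⟩

/-- **Trivial mass of a `d`-periodic twisted block of modulus `m`**: for a twist `w` with `‖w‖ ≤ 1` and samples `g j` with
`‖g j‖ ≤ S` (`S ≥ 0`), `‖Σ_{j : 0 < j.val ≤ T, d·j = 0} (𝓕w)(j)·g j‖ ≤ (T/(m/d))·m·S`. With `OffDiagCharacterSublattice`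
(`dft_factorTwist_eq_zero`: the other heights carry `(𝓕w)(j) = 0`) this prices the `ψ`-block of modulus `m` by at most
`≈ T·d` times the size `S` of one sample. [folklore] -/
theorem norm_sum_lattice_samples_le (hd : d ∣ m) (hd0 : 0 < d) (T : ℕ) {w : ZMod m → ℂ} (hw : ∀ x, ‖w x‖ ≤ 1)
    (g : ZMod m → ℂ) {S : ℝ} (hS : 0 ≤ S)
    (hg : ∀ j : ZMod m, 0 < j.val → j.val ≤ T → ‖g j‖ ≤ S) :
    ‖∑ j ∈ (Finset.univ : Finset (ZMod m)).filter (fun j ↦ 0 < j.val ∧ j.val ≤ T ∧ (d : ZMod m) * j = 0),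
        ZMod.dft w j * g j‖ ≤ ((T / (m / d) : ℕ) : ℝ) * m * S := by
  classical
  set F := (Finset.univ : Finset (ZMod m)).filter (fun j ↦ 0 < j.val ∧ j.val ≤ T ∧ (d : ZMod m) * j = 0) with hF
  have hterm : ∀ j ∈ F, ‖ZMod.dft w j * g j‖ ≤ m * S := by
    intro j hj
    obtain ⟨-, h1, h2, -⟩ := Finset.mem_filter.mp hj
    rw [norm_mul]
    exact mul_le_mul (norm_dft_le_card hw j) (hg j h1 h2) (norm_nonneg _) (Nat.cast_nonneg _)
  calc ‖∑ j ∈ F, ZMod.dft w j * g j‖ ≤ ∑ j ∈ F, ‖ZMod.dft w j * g j‖ := norm_sum_le _ _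
    _ ≤ ∑ _j ∈ F, (m : ℝ) * S := Finset.sum_le_sum hterm
    _ = (F.card : ℝ) * (m * S) := by rw [Finset.sum_const, nsmul_eq_mul]
    _ ≤ ((T / (m / d) : ℕ) : ℝ) * (m * S) := by
        refine mul_le_mul_of_nonneg_right ?_ (by positivity)
        exact_mod_cast card_heights_lattice_le hd hd0 T
    _ = ((T / (m / d) : ℕ) : ℝ) * m * S := by ring

/-- The rounding made explicit: `T/(m/d) ≤ T·d/m ≤ T·d` … in the form the consumer multiplies out:
`(T/(m/d))·m ≤ T·d` for `d ∣ m`, `d ≥ 1`. [folklore] -/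
theorem div_div_mul_le (hd : d ∣ m) (hd0 : 0 < d) (T : ℕ) : ((T / (m / d) : ℕ) : ℝ) * m ≤ (T : ℝ) * d := by
  obtain ⟨k, hk⟩ := hd
  have hk0 : 0 < k := Nat.pos_of_ne_zero fun h ↦ by
    subst h; rw [mul_zero] at hk; exact NeZero.ne m hk
  have hmk : m / d = k := by rw [hk, Nat.mul_div_cancel_left k hd0]
  have hmr : (m : ℝ) = (d : ℝ) * k := by exact_mod_cast hk
  rw [hmk, hmr]
  have h1 : ((T / k : ℕ) : ℝ) ≤ (T : ℝ) / k := Nat.cast_div_le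
  have hk0r : (0 : ℝ) < k := by exact_mod_cast hk0
  calc ((T / k : ℕ) : ℝ) * ((d : ℝ) * k) ≤ (T : ℝ) / k * ((d : ℝ) * k) :=
        mul_le_mul_of_nonneg_right h1 (by positivity)
    _ = (T : ℝ) * d := by field_simp

end Heights

/-! ### §3 Counting the small-conductor characters -/

section Characters

/-- **The (S)/(U) trivial-mass ratio**: `Σ_{1 ≤ d ≤ R} φ(d)·d ≤ R³` — with `φ(d)` characters mod `d`, each `d`-periodic
twisted block costing `≤ d` short-modulus samples' worth (`norm_sum_lattice_samples_le`, `div_div_mul_le`), the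
small-conductor residual is at most `R³` times the principal's trivial mass. [folklore] -/
theorem sum_Icc_totient_mul_le (R : ℕ) : ∑ d ∈ Icc 1 R, (d.totient : ℝ) * d ≤ (R : ℝ) ^ 3 := by
  calc ∑ d ∈ Icc 1 R, (d.totient : ℝ) * d ≤ ∑ _d ∈ Icc 1 R, (R : ℝ) * R := by
        refine Finset.sum_le_sum fun d hd ↦ ?_
        have hdR : (d : ℝ) ≤ R := by exact_mod_cast (Finset.mem_Icc.mp hd).2
        have hφ : (d.totient : ℝ) ≤ d := by exact_mod_cast Nat.totient_le d
        have hd0 : (0 : ℝ) ≤ d := Nat.cast_nonneg _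
        calc (d.totient : ℝ) * d ≤ d * d := mul_le_mul_of_nonneg_right hφ hd0
          _ ≤ R * R := mul_le_mul hdR hdR hd0 (Nat.cast_nonneg _)
    _ = (R : ℝ) ^ 3 := by rw [Finset.sum_const, Nat.card_Icc, nsmul_eq_mul]; push_cast; ring

/-- The same count with the number of characters spelled as a `Fintype.card` (conductors `1 < d ≤ R`), for the
consumer who sums `Σ_{d} Σ_{ψ mod d} d`: `Σ_{d ∈ [2,R]} #(DirichletCharacter ℂ d)·d ≤ R³`. [folklore] -/
theorem sum_Icc_card_dirichletCharacter_mul_le (R : ℕ) :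
    ∑ d ∈ Icc 2 R, (Nat.card (DirichletCharacter ℂ d) : ℝ) * d ≤ (R : ℝ) ^ 3 := by
  have hsub : Icc 2 R ⊆ Icc 1 R := Finset.Icc_subset_Icc_left (by norm_num)
  calc ∑ d ∈ Icc 2 R, (Nat.card (DirichletCharacter ℂ d) : ℝ) * d
      = ∑ d ∈ Icc 2 R, (d.totient : ℝ) * d := by
        refine Finset.sum_congr rfl fun d hd ↦ ?_
        haveI : NeZero d := ⟨by have := (Finset.mem_Icc.mp hd).1; omega⟩
        rw [DirichletCharacter.card_eq_totient_of_hasEnoughRootsOfUnity ℂ d]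
    _ ≤ ∑ d ∈ Icc 1 R, (d.totient : ℝ) * d :=
        Finset.sum_le_sum_of_subset_of_nonneg hsub fun d _ _ ↦ by positivity
    _ ≤ (R : ℝ) ^ 3 := sum_Icc_totient_mul_le R

end Characters

end Summit.Parity.GeneralizedHardyLittlewood.Theorems.BeyondDiagonalBeatsQuarter.OffDiag
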